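import Summits.HubbardSuperconductivity.HubbardSuperconductivity.Theorems.AnisotropyChordTransferFibre3RowCCellSound
import Summits.HubbardSuperconductivity.HubbardSuperconductivity.Theorems.AnisotropyChordTransferFibre3AssemblyHole2

/-!
# Route `AnisotropyChord` / H0 rotor rung, LEVEL-2 certificate: the REGIME / SIDE CONDITION of the GM₃ window as a kernel cell check

The cellwise assembly `gm3_of_cell` (`…GM3Cellwise`) needs, besides the three rows, on each `(ν, a)`-cell the clause
`0 ≤ mHole ∧ facMI·η_eff·(a_D + b/(2 + cos θ)) < c`.  This file reduces it, for EVERY `L ≥ 128` on a cell at once, to ONE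
kernel inequality in p2's `RExpr` frame:
* ANALYSIS: ★ `facMI_mul_etaEff_le`: `facMI·η_eff ≤ η_eff + κ_E·a` (`ĝ₀ ≥ 1 − Δ` for `mHole ≥ 0`, `η_eff = (1−Δ)f(x̂)`, `a = Δf(x̂)`),
  with `η_eff = π²ν`, `κ_E = 3ε₁/(2ε₁ − T⁺) = 3ê₁/(2ê₁ − τ)` (`τ = T⁺/θ² = 3ν − (3/2)Q̂₁/P̂`, `RowC.Tplus_eq_tau`), `2 + cos θ ≥ 2.99`
  (`two_add_cos_ge`), and `mHole ≥ 0 ⇐ τ ≤ 0.499·ê₁` (`mHole_nonneg_of_Tplus_le`) for `L ≥ 128`;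
* PROGRAM: `sideE a_D b c = (π²ν + 3ê₁/(2ê₁ − τ)·a)·(a_D + b·100/299) − c` (claim `≤ −10⁻⁶`) and `mholeE = τ − 0.499ê₁` (claim
  `≤ 0`) on p2's final cell box (`cellFinalBoxC`, ten coordinates), ★ `sideCellCheck c a₁ a₂ a_D b c (prec, iters) : Bool`;
* GLUE: ★ `finalVec_mem_of_cellFinalBoxC` — the true final vector of a ground profile located in the cell lies in p2's final box,
  with its named coordinates (`t, π², ν, a, ê₁, P̂, Q̂₁`); packaged ONCE here for every later cell check (row D, …);
* ★★ `hreg_of_sideCheck`: a passing check gives the regime clause of `gm3_of_cell` for every `L ≥ 128` and every ground profile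
  in the cell (for the given rational `a_D, b ≥ 0` and `c`).
Prover seat `hubbard-h0-rotor-p1` g29 (route lead); helper for piece A = stmt-HubbardSuperconductivity-23918 of rung 19089
(`--supports`, helper class).  Nothing here proves superconductivity in the Hubbard model; one clause of ONE conditional
reduction (the GM₃ ∀L certificate); the rotor TARGET as originally worded stays FALSE (g15 verdict).  Tree imports only; no sorry.
-/

set_option linter.dupNamespace false
set_option autoImplicit false

open Literature.Analysis.ValidatedNumerics

namespace Summit.HubbardSuperconductivity.HubbardSuperconductivity.Theorems.AnisotropyChord.Transfer.Fibre3

namespace RowC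

open L2.N1

variable (L : ℕ) [NeZero L]

/-! ## Analysis: the factor `facMI`, the denominator `2 + cos θ`, the hole margin -/

/-- `ĝ₀ ≥ 1 − Δ` when `mHole ≥ 0` and `0 ≤ Δ`. [folklore] -/
theorem g0hat_ge {Δ : ℝ} {f : Tor L → ℝ} (hΔ0 : 0 ≤ Δ) (hm : 0 ≤ mHole L Δ f) : 1 - Δ ≤ g0hat L Δ f := by
  unfold g0hat
  rw [le_div_iff₀ (by linarith)]
  nlinarith

/-- ★ `facMI·η_eff ≤ η_eff + κ_E·(Δ f(x̂))` for a two-magnon profile with `0 ≤ Δ < 1`, `mHole ≥ 0` (`L ≥ 4`). [folklore] -/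
theorem facMI_mul_etaEff_le (hL : 4 ≤ L) {Δ lam2 : ℝ} {f : Tor L → ℝ} (hΔ0 : 0 ≤ Δ) (hΔ1 : Δ < 1)
    (hf : IsTwoMagnon L Δ lam2 f) (hm : 0 ≤ mHole L Δ f) :
    facMI L Δ f * etaEff L lam2 ≤ etaEff L lam2 + kappaE L Δ f * (Δ * f (K1 L)) := by
  have hη := etaEff_eq L (by omega) hf
  have hg := g0hat_ge L hΔ0 hm
  have hg0 : 0 < g0hat L Δ f := by linarith
  have hT := Tplus_lt_of_mHole_nonneg L hL hm
  have hε := eps1_pos L hL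
  have hκ : 0 ≤ kappaE L Δ f := by
    unfold kappaE; exact div_nonneg (by linarith) (by linarith)
  have hfpos : 0 ≤ f (K1 L) := hf.2.2.1.le
  unfold facMI
  rw [add_mul, one_mul, add_le_add_iff_left, hη]
  -- `κ Δ/ĝ₀ · (1−Δ) f ≤ κ · Δ f` ⟸ `(1−Δ)/ĝ₀ ≤ 1`
  have hg0' : g0hat L Δ f ≠ 0 := hg0.ne'
  have h1 : (1 - Δ) / g0hat L Δ f ≤ 1 := by rw [div_le_one hg0]; exact hg
  have h2 : 0 ≤ kappaE L Δ f * Δ * f (K1 L) := by positivity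
  calc kappaE L Δ f * Δ / g0hat L Δ f * ((1 - Δ) * f (K1 L))
      = kappaE L Δ f * Δ * f (K1 L) * ((1 - Δ) / g0hat L Δ f) := by
        rw [div_mul_eq_mul_div, mul_div_assoc']
        ring
    _ ≤ kappaE L Δ f * Δ * f (K1 L) * 1 := mul_le_mul_of_nonneg_left h1 h2
    _ = kappaE L Δ f * (Δ * f (K1 L)) := by ring

omit [NeZero L] in
/-- `2 + cos(2π/L) ≥ 2.99` for `L ≥ 128`. [folklore] -/
theorem two_add_cos_ge (hL : 128 ≤ L) : 2.99 ≤ 2 + Real.cos (2 * Real.pi / L) := by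
  have hLr : (128 : ℝ) ≤ L := by exact_mod_cast hL
  have hπ := Real.pi_lt_d2
  have hπ0 := Real.pi_pos
  have hx : 2 * Real.pi / (L : ℝ) ≤ 0.05 := by
    rw [div_le_iff₀ (by linarith)]; nlinarith
  have hx0 : 0 ≤ 2 * Real.pi / (L : ℝ) := by positivity
  have hc := Real.one_sub_sq_div_two_le_cos (x := 2 * Real.pi / L)
  nlinarith

/-- `mHole ≥ 0` from `T⁺ ≤ 0.499·ε₁` (`L ≥ 128`). [folklore] -/
theorem mHole_nonneg_of_Tplus_le (hL : 128 ≤ L) {Δ : ℝ} {f : Tor L → ℝ} (h : Tplus L Δ f ≤ 0.499 * eps1 L) :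
    0 ≤ mHole L Δ f := by
  unfold mHole
  have hε := eps1_pos L (by omega)
  have hLr : (128 : ℝ) ≤ L := by exact_mod_cast hL
  have hV : (16384 : ℝ) ≤ (L : ℝ) ^ 2 := by nlinarith
  have hV0 : (0 : ℝ) < (L : ℝ) ^ 2 := by positivity
  have h5 : 5 / (L : ℝ) ^ 2 ≤ 5 / 16384 := div_le_div_of_nonneg_left (by norm_num) (by norm_num) hV
  have h7 : eps1 L * (5 / (L : ℝ) ^ 2) ≤ eps1 L * (5 / 16384) := mul_le_mul_of_nonneg_left h5 hε.le
  have h8 : 0 ≤ eps1 L * (6 / ((L : ℝ) ^ 2) ^ 2) := by positivity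
  have e : eps1 L * (1 - 5 / (L : ℝ) ^ 2 + 6 / ((L : ℝ) ^ 2) ^ 2)
      = eps1 L - eps1 L * (5 / (L : ℝ) ^ 2) + eps1 L * (6 / ((L : ℝ) ^ 2) ^ 2) := by ring
  rw [e]
  linarith

/-! ## The program -/

/-- ★ the side-condition expression `(π²ν + 3ê₁/(2ê₁ − τ)·a)·(a_D + b·100/299) − c` (claim `≤ −10⁻⁶`). -/
def sideE (aD b cc : ℚ) : RExpr :=
  .sub (.mul (.add etaE (.mul (.mul (.mul (cst 3) yE1) (.inv (.sub (.mul (cst 2) yE1) tauE))) yA))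
      (.add (cst aD) (.mul (cst b) (cst (100 / 299)))))
    (cst cc)

/-- the hole-margin expression `τ − 0.499·ê₁` (claim `≤ 0`). -/
def mholeE : RExpr := .sub tauE (.mul (cst (499 / 1000)) yE1)

/-- ★ THE SIDE-CONDITION CELL CHECK on the `(ν, a)`-cell of `c, a₁, a₂` (all `L ≥ 128`): `a_D, b ≥ 0`, the final box exists,
`P̂ ≥ 1`, `τ ≤ 0.499ê₁` and `sideE ≤ −10⁻⁶` on it. -/
def sideCellCheck (c : L2.NamedCell) (a1 a2 aD b cc : ℚ) (pi : ℕ × ℕ) : Bool :=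
  decide (0 ≤ aD) && decide (0 ≤ b) &&
  match cellFinalBoxC c a1 a2 2 pi with
  | none => false
  | some F =>
    rexprLeOn (.neg yP) (-1) F pi &&
    rexprLeOn mholeE 0 F pi &&
    rexprLeOn (sideE aD b cc) (-1 / 1000000) F pi

/-! ## Evaluation lemmas -/

/-- `sideE` evaluates. -/
theorem eval_sideE (y : ℕ → ℝ) (hπ : y 1 = Real.pi ^ 2) (aD b cc : ℚ) :
    (sideE aD b cc).eval y
      = (Real.pi ^ 2 * y 2 + 3 * y 4 * (2 * y 4 - (3 * y 2 - 3 / 2 * y 8 * (y 6)⁻¹))⁻¹ * y 3)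
          * ((aD : ℝ) + (b : ℝ) * (100 / 299)) - (cc : ℝ) := by
  have h3 := eval_tauE y
  have he := eval_etaE y hπ
  simp only [sideE, cst, yE1, yA, RExpr.eval] at *
  rw [h3, he]; unfold etaN; push_cast; ring

/-- `mholeE` evaluates. -/
theorem eval_mholeE (y : ℕ → ℝ) : mholeE.eval y = (3 * y 2 - 3 / 2 * y 8 * (y 6)⁻¹) - 499 / 1000 * y 4 := by
  have h3 := eval_tauE y
  simp only [mholeE, cst, yE1, RExpr.eval] at *
  rw [h3]; push_cast; ring

/-! ## Glue: the true final vector lies in p2's final box -/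

/-- ★ for a ground profile located in the cell and a successful `cellFinalBoxC`, the final vector of the true data lies in the
final box, with coordinates `y₀ = t`, `y₁ = π²`, `y₂ = ν`, `y₃ = a`, `y₄ = ê₁`, `y₆ = P̂ = t³ΣF₂³`, `y₈ = Q̂₁ = t²Σ n_K F₂`. [folklore] -/
theorem finalVec_mem_of_cellFinalBoxC (c : L2.NamedCell) (a1 a2 : ℚ) (pi : ℕ × ℕ) {F : Box}
    (hF : cellFinalBoxC c a1 a2 2 pi = some F) (hc : c.check = true) (hL : 128 ≤ L)
    {Δ lam2 : ℝ} {f : Tor L → ℝ} (hΔ0 : 0 ≤ Δ) (hΔ1 : Δ < 1) (hf : IsGroundTwoMagnon L Δ lam2 f)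
    (hν1 : (c.n1 : ℝ) / c.νd ≤ lam2 / (2 * Real.pi / L) ^ 2) (hν2 : lam2 / (2 * Real.pi / L) ^ 2 ≤ (c.n2 : ℝ) / c.νd)
    (ha1 : ((a1 : ℚ) : ℝ) ≤ Δ * f (K1 L)) (ha2 : Δ * f (K1 L) ≤ ((a2 : ℚ) : ℝ)) :
    let t : ℝ := (2 * Real.pi / L) ^ 2
    ∃ y : ℕ → ℝ, F.mem y ∧ y 0 = t ∧ y 1 = Real.pi ^ 2 ∧ y 2 = lam2 / t ∧ y 3 = Δ * f (K1 L) ∧ y 4 = eps1 L / t ∧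
      y 6 = t ^ 3 * ∑ k : Tor L, F2 L f k ^ 3 ∧ y 8 = t ^ 2 * ∑ k : Tor L, nK L f k * F2 L f k := by
  classical
  intro t
  set X := xTrue L Δ lam2 f (Δ * f (K1 L)) with hXdef
  have hLpos : (0 : ℝ) < L := by exact_mod_cast (show 0 < L by omega)
  have hπ := Real.pi_pos
  have ht0 : 0 < t := by positivity
  -- regime facts (as in `trialGap_of_cellCheck` / `rowC_core`)
  have hlam : 0 < lam2 := lam2_pos L (by omega) hΔ1 hf.1
  have h2 : 2 * lam2 < eps1 L := two_lam2_lt_eps1 L (by omega) hΔ0 hf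
  obtain ⟨ha0, haV, _, _⟩ := ManifoldA.manifold_band L hL hΔ0 hΔ1 hf
  have hνc := ManifoldA.nu_ceiling L hL hΔ0 hf
  have hν4 : lam2 / (2 * Real.pi / L) ^ 2 < 4 / Real.pi ^ 2 := by
    rw [div_lt_iff₀ ht0]
    have hπ2 : Real.pi ^ 2 < 10 := by nlinarith [Real.pi_lt_d2, Real.pi_pos]
    have : (0.031 : ℝ) ≤ 4 / Real.pi ^ 2 := by rw [le_div_iff₀ (by positivity)]; nlinarith
    nlinarith
  have hV1 : (1 : ℝ) / (L : ℝ) ^ 2 = t * (4 * Real.pi ^ 2)⁻¹ := by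
    show (1 : ℝ) / (L : ℝ) ^ 2 = (2 * Real.pi / L) ^ 2 * (4 * Real.pi ^ 2)⁻¹
    field_simp; ring
  have hu' : 0 < 1 - Δ * f (K1 L) + Δ * f (K1 L) * ((2 * Real.pi / L) ^ 2 * (4 * Real.pi ^ 2)⁻¹) := by
    have : (2 * Real.pi / (L : ℝ)) ^ 2 * (4 * Real.pi ^ 2)⁻¹ = 1 / (L : ℝ) ^ 2 := hV1.symm
    rw [this]; nlinarith
  obtain ⟨_, _, _, _, d5, _, _⟩ := ManifoldA.manifold_dictionary L (by omega) hΔ0 hΔ1 hf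
  have hu : 0 < cS L Δ lam2 f * Gzero L lam2 := by
    rw [← Gres_zero_zero_eq_Gzero, d5]
    have : Δ * f (K1 L) / (L : ℝ) ^ 2 = Δ * f (K1 L) * ((2 * Real.pi / L) ^ 2 * (4 * Real.pi ^ 2)⁻¹) := by
      rw [← hV1]; ring
    rw [this]; exact hu'
  -- the interval layer of p2
  have hPM : PMem (c.box a1 a2) X := pmem_xTrue c hc a1 a2 L hL Δ lam2 f _ hν1 hν2 ha1 ha2
  have hsp := xTrue_specs_ground L Δ lam2 f (by omega) hΔ0 hΔ1 hf hlam h2 hν4 ha0 hu'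
  set vP : ℝ := t ^ 3 * ∑ k : Tor L, F2 L f k ^ 3 with hvP
  set vQ : ℝ := t ^ 2 * ∑ k : Tor L, nK L f k * F2 L f k with hvQ
  set vB : ℝ := ((2 * Real.pi / L) ^ 2) ^ 3 * ∑ k : Tor L, F2 L f k ^ 2 * F2 L f (k + K1 L) with hvB
  set vA : ℝ := ((2 * Real.pi / L) ^ 2) ^ 2 * ∑ k : Tor L, F2 L f k ^ 2 * cosx L k with hvA
  set vJ : ℝ := ((2 * Real.pi / L) ^ 2) ^ 2 * ∑ k : Tor L, bcJ L f k with hvJ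
  have oB := bHat_mem L Δ lam2 f (by omega) hΔ0 hΔ1 hf hlam h2 hu
  have oP := pHat_mem L Δ lam2 f (by omega) hΔ0 hΔ1 hf hlam h2 hu
  have oA := aHat_mem L Δ lam2 f (by omega) hΔ0 hΔ1 hf hlam h2 hu
  have oQ := q1Hat_mem L Δ lam2 f (by omega) hΔ0 hΔ1 hf hlam h2 hu
  have oJ := j1Hat_mem L Δ lam2 f (by omega) hΔ0 hΔ1 hf hlam h2 hu
  have hob : ∀ j (hj : j < (objSpecsC 2).length) (hj' : j < [vB, vP, vA, vQ, vJ].length),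
      ((objSpecsC 2)[j].1).eval X ≤ [vB, vP, vA, vQ, vJ][j] ∧ [vB, vP, vA, vQ, vJ][j] ≤ ((objSpecsC 2)[j].2).eval X := by
    intro j hj hj'
    have hj5 : j < 5 := by simpa [objSpecsC] using hj
    interval_cases j
    · simpa [objSpecsC] using oB
    · simpa [objSpecsC] using oP
    · simpa [objSpecsC] using oA
    · simpa [objSpecsC] using oQ
    · simpa [objSpecsC] using oJ
  have hlen0 : (c.box a1 a2).length = 16 := by simp [L2.NamedCell.box]
  have hv := specsVarsOkC_two
  simp only [specsVarsOkC, Bool.and_eq_true] at hv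
  obtain ⟨hv1, hv2⟩ := hv
  have hS : SpecsHold X (c.box a1 a2).length (specs 2) := by
    rw [hlen0]; exact specsHold_of X (specs 2) 16 hv1 hsp
  unfold cellFinalBoxC cellBox at hF
  split at hF
  · exact absurd hF (by simp)
  · rename_i B hB
    split at hF
    · exact absurd hF (by simp)
    · rename_i objs hobjs
      simp only [Option.some.injEq] at hF
      subst hF
      obtain ⟨hPB, hlenB⟩ := extendBox_sound pi.1 pi.2 X (specs 2) _ B hB hPM hS
      have hO : ObjsHold X B.length (objSpecsC 2) [vB, vP, vA, vQ, vJ] := by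
        rw [hlenB, hlen0]
        exact objsHold_of X _ (objSpecsC 2) [vB, vP, vA, vQ, vJ] (by simp [objSpecsC]) hv2 hob
      have hbr := encloseObjs_sound pi.1 pi.2 hPB (objSpecsC 2) [vB, vP, vA, vQ, vJ] objs hobjs hO
      have hmem := finalBox_mem hPB (by
        rw [hlenB, hlen0]
        simp only [specs, List.length_append, List.length_cons, List.length_nil, List.length_map]
        omega) hbr
      obtain ⟨y0, y1, y2, y3, y4, y5, y6, y7, y8, y9⟩ := finalVec_vals X vB vP vA vQ vJ
      have hX0 : X 0 = t := xTrue_zero L Δ lam2 f _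
      have hX1 : X 1 = Real.pi ^ 2 := by rw [hXdef, xTrue_lt16 L Δ lam2 f _ (by norm_num)]; rfl
      have hX2 : X 2 = lam2 / t := by rw [hXdef, xTrue_lt16 L Δ lam2 f _ (by norm_num)]; rfl
      have hX3 : X 3 = Δ * f (K1 L) := by rw [hXdef, xTrue_lt16 L Δ lam2 f _ (by norm_num)]; rfl
      have hX16 : X 16 = eps1 L / t := by rw [hXdef, xTrue_16]; rfl
      refine ⟨finalVec X [vB, vP, vA, vQ, vJ], hmem, ?_, ?_, ?_, ?_, ?_, ?_, ?_⟩
      · rw [y0, hX0]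
      · rw [y1, hX1]
      · rw [y2, hX2]
      · rw [y3, hX3]
      · rw [y4, hX16]
      · rw [y6]
      · rw [y8]

/-! ## Soundness -/

/-- ★★ **A PASSING SIDE-CONDITION CHECK GIVES THE REGIME CLAUSE OF `gm3_of_cell` FOR EVERY `L ≥ 128` ON THE CELL**:
`0 ≤ mHole` and `facMI·η_eff·(a_D + b/(2 + cos θ)) < c`. -/
theorem hreg_of_sideCheck (c : L2.NamedCell) (a1 a2 aD b cc : ℚ) (pi : ℕ × ℕ)
    (hchk : sideCellCheck c a1 a2 aD b cc pi = true) (hc : c.check = true) (hL : 128 ≤ L)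
    {Δ lam2 : ℝ} {f : Tor L → ℝ} (hΔ0 : 0 ≤ Δ) (hΔ1 : Δ < 1) (hf : IsGroundTwoMagnon L Δ lam2 f)
    (hν1 : (c.n1 : ℝ) / c.νd ≤ lam2 / (2 * Real.pi / L) ^ 2) (hν2 : lam2 / (2 * Real.pi / L) ^ 2 ≤ (c.n2 : ℝ) / c.νd)
    (ha1 : ((a1 : ℚ) : ℝ) ≤ Δ * f (K1 L)) (ha2 : Δ * f (K1 L) ≤ ((a2 : ℚ) : ℝ)) :
    0 ≤ mHole L Δ f ∧
      facMI L Δ f * etaEff L lam2 * ((aD : ℝ) + (b : ℝ) / (2 + Real.cos (2 * Real.pi / L))) < (cc : ℝ) := by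
  have hLpos : (0 : ℝ) < L := by exact_mod_cast (show 0 < L by omega)
  have hπ := Real.pi_pos
  have hL2 : 2 ≤ L := by omega
  set t : ℝ := (2 * Real.pi / L) ^ 2 with ht
  have ht0 : 0 < t := by positivity
  -- unpack the check
  unfold sideCellCheck at hchk
  simp only [Bool.and_eq_true, decide_eq_true_eq] at hchk
  obtain ⟨⟨haD, hb⟩, hrest⟩ := hchk
  split at hrest
  · exact absurd hrest (by simp)
  · rename_i F hF
    simp only [Bool.and_eq_true] at hrest
    obtain ⟨⟨hP, hM⟩, hS⟩ := hrest
    obtain ⟨y, hmem, g0, g1, g2, g3, g4, g6, g8⟩ :=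
      finalVec_mem_of_cellFinalBoxC L c a1 a2 pi hF hc hL hΔ0 hΔ1 hf hν1 hν2 ha1 ha2
    rw [← ht] at g0 g2 g4 g6 g8
    set vP : ℝ := t ^ 3 * ∑ k : Tor L, F2 L f k ^ 3 with hvP
    set vQ : ℝ := t ^ 2 * ∑ k : Tor L, nK L f k * F2 L f k with hvQ
    have eP := rexprLeOn_sound hP _ hmem
    have eM := rexprLeOn_sound hM _ hmem
    have eS := rexprLeOn_sound hS _ hmem
    simp only [yP, RExpr.eval] at eP
    rw [eval_mholeE] at eM
    rw [eval_sideE y g1] at eS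
    rw [g6] at eP
    rw [g2, g4, g6, g8] at eM
    rw [g2, g3, g4, g6, g8] at eS
    push_cast at eP eM eS
    have hvP0 : 0 < vP := by linarith
    -- `T⁺ = t·τ`
    have hT := Tplus_eq_tau L hL2 hf (by rw [← ht]; exact hvP0)
    rw [← ht] at hT
    set τ : ℝ := 3 * (lam2 / t) - 3 / 2 * vQ * vP⁻¹ with hτ
    have hTt : Tplus L Δ f = t * τ := by rw [hT]
    have hε := eps1_pos L (by omega)
    have hεt : eps1 L = t * (eps1 L / t) := by field_simp
    -- the hole margin
    have hm : 0 ≤ mHole L Δ f := by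
      apply mHole_nonneg_of_Tplus_le L hL
      rw [hTt]
      have : t * τ ≤ t * (499 / 1000 * (eps1 L / t)) := mul_le_mul_of_nonneg_left (by linarith) ht0.le
      calc t * τ ≤ t * (499 / 1000 * (eps1 L / t)) := this
        _ = 0.499 * eps1 L := by field_simp; ring
    refine ⟨hm, ?_⟩
    -- the factor
    have hfac := facMI_mul_etaEff_le L (by omega) hΔ0 hΔ1 hf.1 hm
    have hTlt := Tplus_lt_of_mHole_nonneg L (by omega) hm
    have hden : 0 < 2 * eps1 L - t * τ := by rw [← hTt]; linarith
    have ht0' : t ≠ 0 := ht0.ne'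
    have hκ : 3 * (eps1 L / t) * (2 * (eps1 L / t) - τ)⁻¹ = kappaE L Δ f := by
      unfold kappaE
      rw [hTt]
      have e : 2 * (eps1 L / t) - τ = (2 * eps1 L - t * τ) / t := by field_simp
      rw [e, inv_div]
      field_simp
    obtain ⟨_, _, _, _, _, _, d7⟩ := ManifoldA.manifold_dictionary L (by omega) hΔ0 hΔ1 hf
    rw [← ht] at d7
    set A : ℝ := Real.pi ^ 2 * (lam2 / t) + 3 * (eps1 L / t) * (2 * (eps1 L / t) - τ)⁻¹ * (Δ * f (K1 L)) with hA
    have hfacA : facMI L Δ f * etaEff L lam2 ≤ A := by rw [hA, hκ, ← d7]; exact hfac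
    have hρ := two_add_cos_ge L hL
    have hb0 : (0 : ℝ) ≤ (b : ℝ) := by exact_mod_cast hb
    have haD0 : (0 : ℝ) ≤ (aD : ℝ) := by exact_mod_cast haD
    have hBq : (aD : ℝ) + (b : ℝ) / (2 + Real.cos (2 * Real.pi / L)) ≤ (aD : ℝ) + (b : ℝ) * (100 / 299) := by
      have h1 : (b : ℝ) / (2 + Real.cos (2 * Real.pi / L)) ≤ (b : ℝ) / 2.99 :=
        div_le_div_of_nonneg_left hb0 (by norm_num) hρ
      have e : (b : ℝ) / 2.99 = (b : ℝ) * (100 / 299) := by ring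
      linarith
    have hB0 : 0 ≤ (aD : ℝ) + (b : ℝ) / (2 + Real.cos (2 * Real.pi / L)) :=
      add_nonneg haD0 (div_nonneg hb0 (by linarith))
    have hlam : 0 < lam2 := lam2_pos L (by omega) hΔ1 hf.1
    have hfac0 : 0 ≤ facMI L Δ f * etaEff L lam2 := by
      have hη : 0 < etaEff L lam2 := by unfold etaEff; positivity
      have hκ0 : 0 ≤ kappaE L Δ f := by
        unfold kappaE; exact div_nonneg (by linarith) (by linarith)
      have hg0 : 0 < g0hat L Δ f := by have := g0hat_ge L hΔ0 hm; linarith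
      have : 0 ≤ facMI L Δ f := by unfold facMI; positivity
      positivity
    have hA0 : 0 ≤ A := le_trans hfac0 hfacA
    calc facMI L Δ f * etaEff L lam2 * ((aD : ℝ) + (b : ℝ) / (2 + Real.cos (2 * Real.pi / L)))
        ≤ A * ((aD : ℝ) + (b : ℝ) / (2 + Real.cos (2 * Real.pi / L))) := mul_le_mul_of_nonneg_right hfacA hB0
      _ ≤ A * ((aD : ℝ) + (b : ℝ) * (100 / 299)) := mul_le_mul_of_nonneg_left hBq hA0
      _ < (cc : ℝ) := by rw [hA]; linarith

end RowC

end Summit.HubbardSuperconductivity.HubbardSuperconductivity.Theorems.AnisotropyChord.Transfer.Fibre3
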